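import Summits.RiemannHypothesis.RiemannHypothesis.Theorems.TiltedLandingLaw421R3DimpleSig
import Summits.RiemannHypothesis.RiemannHypothesis.Theorems.TiltedLandingLaw421R3SuccTheft
import Summits.RiemannHypothesis.RiemannHypothesis.Theorems.TiltedLandingLaw421R3AddOn

/-! # TiltedLandingLaw421 — round 3q, C1 g27 «words / typing / kernel»: DOOR AUDIT of the lineage law, and the repaired lineage doors

W-08 C1 rh-idea-5 g27 (files-only seat). Kernel content only; every statement below is either PROVED here or an explicitly
named OPEN door (`def … : Prop`). Nothing here bears on the truth of RH; RH is not proved; item 24774 stays OPEN.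

## §1 AUDIT — `LineageLawQ` / `MarginBand` (C1 g26, ColumnImmunity-v7 `0ae57833` / -v8 `86924b8b` §3; NOT in tree) COLLAPSES

g26 typed the critic's (E3) «lineage with lateral margin `R/2`» as
`MarginBand x₀ R Hs j u : (|Re u − x₀| + R/2)² + (j+1)·(Im u)² ≤ (j+1)·Hs²` and the door
`LineageLawQ : legal frame → ∀ j v, f^{(j)} ≢ 0 → ¬Ready′_j → ∃ u, f^{(j+1)} u = 0 ∧ 0 < Im u ∧ MarginBand x₀ R Hs j u`.
On a legal frame `2·Hs ≤ R`, so `(|Re u − x₀| + R/2)² ≥ (R/2)² ≥ Hs²`: at `j = 0` the margin band meets the open upper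
half-plane in the EMPTY set (`not_ci8MarginBand_zero`), and more generally whenever `(j+1)·Hs² ≤ (R/2)²`
(`im_eq_zero_of_ci8MarginBand`). Consequently (`ci8LineageLawQ_iff_readyZero`)

  `LineageLawQ ⟺ ReadyZeroLawQ := «every legal frame is Ready′ at level 0»`,

which is false in model (critic RESULT-21 colaw4: LEGAL, levels 0–12 not Ready′; C6 ADD-126: 151 cumulatively non-Ready′
legal levels). VERDICT: `LineageLawQ`/`MarginBand` are STRUCK as doors (the K-lemmas `LineageLawQ → AntiEscape → RestSuccBotQ` of
v7/v8 §3 are valid but vacuous); v7/v8 §1–§2 (column immunity), §4–§5 (`ResidualQ`, `ResidualSignQ`) are unaffected. The same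
defect sits in the literal (E3) typing `(ρ(u) + R/2)² ≤ (j+1)(Hs² − Im u²)`: `ρ(u) + R/2 = max(|Re u − x₀|, R/2) ≥ R/2 ≥ Hs`.
What Cauchy–Schwarz on a nested chain `u₀ = w₀, u₁, …, u_j` (`Re w₀ = x₀`) actually gives is the PURE quadratic window
`(Re u_j − x₀)² + j·(Im u_j)² ≤ j·(Im w₀)² ≤ j·Hs²` (no `R/2` anywhere) — §3 below.

## §2 REPAIRED DOORS IN THE TREE'S CURRENCY (band family `StTrkDQ`), with the by-name equivalences

* `BandLineageLawQ` (state-free): legal frame, level `j` cumulatively not Ready′ ⇒ the level-`(j+1)` BAND is inhabited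
  (`∃ u, StTrkDQ … (j+1) u`). This is exactly the shape C6 ADD-126 (4)(ii) reports as surviving on all 1 699 + 1 235 levels.
* `StepLawQ` (one step): a level-`j` band state at a non-Ready′ level ⇒ a level-`(j+1)` band state.
* PROVED: `BandLineageLawQ ↔ StepLawQ ↔ RestSuccBotQ` (`restSuccBotQ_iff_stepLawQ`, `restSuccBotQ_iff_bandLineageLawQ`):
  STUB 1 of the registered line `trkD_v3q` IS the state-free band lineage law — the `IsLowest` state, the `s/4` drop clause of
  `Charged`, and (cf. `AntiEscape`) the ¬window/¬dimple hypotheses are all inessential. Hands may therefore produce the level-`(j+1)`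
  band state by ANY mechanism (w₀-lineage while nested, column immunity (E1) while the column holds an upper zero of `f^{(j+1)}`,
  the roof pair's disc child of ADD-126, …) — nothing ties the successor to the lowest state.
* `BandLineageLawQ → AntiEscape` (`antiEscape_of_bandLineageLawQ`), for the record.

## §3 THE PURE-Q MECHANISM (sharper, census target): `QStepLawQ ⇒ QLineageLawQ ⇒ BandLineageLawQ`

`QWin x₀ H j u : (Re u − x₀)² + j·(Im u)² ≤ j·H²` (level 0 = the column LINE `Re u = x₀`, `qWin_zero_iff`); it is a NESTED-STEP
INVARIANT (`qWin_step`, = tree `quad_step'`) and sits inside the band (`stTrkDQ_of_qWin`, = tree `band_of_quad'`).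
`QLineageLawQ`: non-Ready′ level `j` ⇒ an upper zero of `f^{(j+1)}` in `QWin x₀ Hs (j+1)`; `QStepLawQ`: a `QWin_j` upper zero of
`f^{(j)}` at a non-Ready′ level has a `QWin_{j+1}` upper zero of `f^{(j+1)}` (ANY, not necessarily nested); `QTheftLawQ`: the same
with «no nested upper zero of `f^{(j+1)}` under `v`» added — the nested case is a theorem (`qStepLawQ_of_qTheftLawQ`), so the open
content is THEFT/EXTINCTION only, as for `AntiTheft`. PROVED: `QTheftLawQ → QStepLawQ → QLineageLawQ → BandLineageLawQ → RestSuccBotQ`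
(induction from the reflected seed `w₀ ∈ QWin x₀ Hs 0`, `exists_seed_qWin`). DEAD VARIANT (do not type): the w₀-ROOF window
`QWin x₀ (Im w₀)` — C6 ADD-126's legal frame `e^{−3z}(z²+0.35²)((z−1.02)²+0.9²)` has `w₀ = 0.35·i` robbed at level 0 → 1 (loot at
`|w − Re w₀| = 1.0082·Im w₀`), while `QWin 0 0.95 1` holds there with slack (`0.1245 ≤ 0.9025`).

## §4 NON-TERMINALITY (needed by the K-lemmas, useful on its own)

`readyR2_of_iteratedDeriv_succ_eq_zero`: `f^{(j)} ≢ 0 ∧ f^{(j+1)} ≡ 0 ⇒ Ready′_j` (then `f^{(j)}` is a non-zero REAL constant and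
`x₀` carries a degenerate 421-event); hence `iteratedDeriv_ne_zero_of_not_readyR2`: at a non-Ready′ level `f^{(j)} ≢ 0` and
`f^{(j+1)} ≢ 0` (polynomial frames are Ready′ from their degree on).

Imports: tree `…R3DimpleSig` + `…R3SuccTheft` only. Namespace `RhW08.LineageQ`. -/

namespace RhW08.LineageQ

open Complex Set
open scoped ComplexConjugate
open Literature.Analysis.Complex
open RhIdea6.G17.W07C7 RhIdea6.G17.W07C7.Rev6 RhIdea6.G18.W07C8.Law421BirthS RhIdea6.G19.W07C11.Seam
open RhIdea6.G20.W07C12.Frac RhIdea6.G20.W07C12.StColP RhW07.C12.FieldSplit RhIdea6.G21.W07C13.TentMax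
open RhW07.C14.TwoSided RhW07.C14.Classes RhW07.C14.Lineage RhW07.C14.Booking
open RhW07.C13.Heredity RhIdea6.G22.W07C15pre.Injection RhW07.E3.Cell RhW07.E3.Lit
open RhW08.Round1 RhW08.StSwap RhW08.Round2 RhW08.QuadW RhW08.SealSwapQ RhW08.SealSwap RhW08.SuccB RhW08.SuccSplit RhW08.SuccTheft

/-! ## §0 Frame facts -/

/-- Frame inequalities out of `EngineHyps5 2`: `0 < s`, `0 < R`, `0 ≤ Hs`, `2·Hs ≤ R`. -/
theorem frame_pos {η : ℝ} {f : ℂ → ℂ} {x₀ s hmax R Hs : ℝ} {B : ℕ} (hE : EngineHyps5 2 η f x₀ s hmax R Hs B) :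
    0 < s ∧ 0 < R ∧ 0 ≤ Hs ∧ 2 * Hs ≤ R := by
  have h1 : 0 < s := hE.2.2.2.1
  have h2 : 2 * s ≤ hmax := hE.2.2.2.2.1
  have h3 : 3 * hmax < R := hE.2.2.2.2.2.2.1
  have h4 : 0 ≤ Hs := hE.2.2.2.2.2.2.2.1
  have h5 : 2 * Hs ≤ R := hE.2.2.2.2.2.2.2.2.2.1
  exact ⟨h1, by linarith, h4, h5⟩

/-- On a legal frame `f ≢ 0` (the zero function violates the zero-strip hypothesis at `(Hs+1)·i`). -/
theorem iteratedDeriv_zero_ne_zero {η : ℝ} {f : ℂ → ℂ} {x₀ s hmax R Hs : ℝ} {B : ℕ} (hE : EngineHyps5 2 η f x₀ s hmax R Hs B) :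
    iteratedDeriv 0 f ≠ 0 := by
  intro hf0
  rw [iteratedDeriv_zero] at hf0
  have hHs : 0 ≤ Hs := hE.2.2.2.2.2.2.2.1
  have hstrip : ∀ w : ℂ, f w = 0 → |w.im| ≤ Hs := hE.2.2.2.2.2.2.2.2.1
  have h := hstrip ((Hs + 1 : ℝ) * I) (by rw [hf0]; rfl)
  have him : (((Hs + 1 : ℝ) : ℂ) * I).im = Hs + 1 := by simp
  rw [him, abs_of_nonneg (by linarith)] at h
  linarith

/-! ## §1 AUDIT of g26's `MarginBand` / `LineageLawQ` (verbatim copies under audit names) -/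

/-- VERBATIM copy of `RhW08.Column.MarginBand` (C1 g26 ColumnImmunity-v7 and -v8 §3, not in tree), under an audit name:
`(|Re u − x₀| + R/2)² + (j+1)·(Im u)² ≤ (j+1)·Hs²`. -/
def CI8MarginBand (x₀ R Hs : ℝ) (j : ℕ) (u : ℂ) : Prop :=
  (|u.re - x₀| + R / 2) ^ 2 + ((j : ℝ) + 1) * u.im ^ 2 ≤ ((j : ℝ) + 1) * Hs ^ 2

/-- VERBATIM copy of `RhW08.Column.LineageLawQ` (C1 g26 ColumnImmunity-v7 and -v8 §3, not in tree), under an audit name. -/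
def CI8LineageLawQ : Prop :=
  ∀ (η : ℝ) (f : ℂ → ℂ) (x₀ s hmax R Hs : ℝ) (B : ℕ), EngineHyps5 2 η f x₀ s hmax R Hs B → ∀ (j : ℕ) (v : ℂ),
    iteratedDeriv j f ≠ 0 → ¬ ReadyR2 η f x₀ s hmax R Hs B j v →
    ∃ u : ℂ, iteratedDeriv (j + 1) f u = 0 ∧ 0 < u.im ∧ CI8MarginBand x₀ R Hs j u

/-- «Every legal frame is Ready′ at level 0» — the law `CI8LineageLawQ` collapses to (false in model: critic RESULT-21 colaw4). -/
def ReadyZeroLawQ : Prop :=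
  ∀ (η : ℝ) (f : ℂ → ℂ) (x₀ s hmax R Hs : ℝ) (B : ℕ), EngineHyps5 2 η f x₀ s hmax R Hs B → ∀ v : ℂ, ReadyR2 η f x₀ s hmax R Hs B 0 v

/-- ★ AUDIT 1: the margin band forces `Im u = 0` whenever `(j+1)·Hs² ≤ (R/2)²` — in particular at `j = 0` on every legal frame. -/
theorem im_eq_zero_of_ci8MarginBand {x₀ R Hs : ℝ} {j : ℕ} {u : ℂ} (hR : 0 ≤ R)
    (hthin : ((j : ℝ) + 1) * Hs ^ 2 ≤ (R / 2) ^ 2) (hm : CI8MarginBand x₀ R Hs j u) : u.im = 0 := by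
  unfold CI8MarginBand at hm
  have ha : 0 ≤ |u.re - x₀| := abs_nonneg _
  have h1 : (R / 2) ^ 2 ≤ (|u.re - x₀| + R / 2) ^ 2 := pow_le_pow_left₀ (by linarith) (by linarith) 2
  have hj : (0 : ℝ) < (j : ℝ) + 1 := by positivity
  have h2 : ((j : ℝ) + 1) * u.im ^ 2 ≤ ((j : ℝ) + 1) * 0 := by linarith
  have h3 : u.im ^ 2 ≤ 0 := le_of_mul_le_mul_left h2 hj
  exact pow_eq_zero_iff two_ne_zero |>.mp (le_antisymm h3 (sq_nonneg _))

/-- ★ AUDIT 2: on a legal frame the level-0 margin band contains NO point of the open upper half-plane. -/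
theorem not_ci8MarginBand_zero {η : ℝ} {f : ℂ → ℂ} {x₀ s hmax R Hs : ℝ} {B : ℕ} (hE : EngineHyps5 2 η f x₀ s hmax R Hs B)
    {u : ℂ} (hu : 0 < u.im) : ¬ CI8MarginBand x₀ R Hs 0 u := by
  intro hm
  obtain ⟨-, hR, hHs, h2⟩ := frame_pos hE
  have hthin : (((0 : ℕ) : ℝ) + 1) * Hs ^ 2 ≤ (R / 2) ^ 2 := by
    push_cast
    nlinarith [mul_nonneg hHs hHs, mul_nonneg hHs (by linarith : 0 ≤ R / 2 - Hs)]
  exact hu.ne' (im_eq_zero_of_ci8MarginBand hR.le hthin hm)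

/-- ★★ AUDIT 3 — THE COLLAPSE: `CI8LineageLawQ ↔ ReadyZeroLawQ`. (⇒: at level 0 the promised margin-band zero cannot exist, so no
legal frame may be non-Ready′ at level 0; ⇐: Ready′ is cumulative, so the law's hypothesis is never met.) -/
theorem ci8LineageLawQ_iff_readyZero : CI8LineageLawQ ↔ ReadyZeroLawQ := by
  constructor
  · intro h η f x₀ s hmax R Hs B hE v
    by_contra hnr
    obtain ⟨u, -, hup, hm⟩ := h η f x₀ s hmax R Hs B hE 0 v (iteratedDeriv_zero_ne_zero hE) hnr
    exact not_ci8MarginBand_zero hE hup hm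
  · intro h η f x₀ s hmax R Hs B hE j v _ hnr
    exact absurd (readyR2_mono (h η f x₀ s hmax R Hs B hE v) (Nat.zero_le j)) hnr

/-! ## §2 The pure quadratic window `QWin` -/

/-- The PURE quadratic window at level `j` with roof `H`: `(Re u − x₀)² + j·(Im u)² ≤ j·H²` (Cauchy–Schwarz envelope of a nested chain of
`j` steps started on the line `Re = x₀` at height `≤ H`; NO lateral `R/2` allowance — compare the band `StColQ'`). -/
def QWin (x₀ H : ℝ) (j : ℕ) (u : ℂ) : Prop := (u.re - x₀) ^ 2 + (j : ℝ) * u.im ^ 2 ≤ (j : ℝ) * H ^ 2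

/-- Level 0 of the window is the column LINE `Re u = x₀`. -/
theorem qWin_zero_iff {x₀ H : ℝ} {u : ℂ} : QWin x₀ H 0 u ↔ u.re = x₀ := by
  unfold QWin
  push_cast
  simp only [zero_mul, add_zero]
  constructor
  · intro h
    have h0 : (u.re - x₀) ^ 2 = 0 := le_antisymm h (sq_nonneg _)
    exact sub_eq_zero.mp (pow_eq_zero_iff two_ne_zero |>.mp h0)
  · intro h
    rw [h, sub_self]
    simp

/-- At a positive level the window bounds the height: `QWin x₀ H (j+1) u`, `0 ≤ H` ⇒ `Im u ≤ H`. -/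
theorem im_le_of_qWin_succ {x₀ H : ℝ} {j : ℕ} {u : ℂ} (hH : 0 ≤ H) (h : QWin x₀ H (j + 1) u) : u.im ≤ H := by
  unfold QWin at h
  push_cast at h
  have hj : (0 : ℝ) < (j : ℝ) + 1 := by positivity
  have h2 : ((j : ℝ) + 1) * u.im ^ 2 ≤ ((j : ℝ) + 1) * H ^ 2 := by nlinarith [sq_nonneg (u.re - x₀)]
  have h1 : u.im ^ 2 ≤ H ^ 2 := le_of_mul_le_mul_left h2 hj
  exact (abs_le_of_sq_le_sq' h1 hH).2

/-- ★ THE WINDOW IS A NESTED-STEP INVARIANT (tree `quad_step'`): `QWin x₀ H j v`, `Im v² ≤ H²`, `NestedStep v w` ⇒ `QWin x₀ H (j+1) w`. -/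
theorem qWin_step {x₀ H : ℝ} {j : ℕ} {v w : ℂ} (hv : QWin x₀ H j v) (hH : v.im ^ 2 ≤ H ^ 2) (hn : NestedStep v w) :
    QWin x₀ H (j + 1) w := by
  unfold QWin at hv ⊢
  unfold NestedStep at hn
  have h := quad_step' (x := v.re - x₀) (b := v.im) (δ := w.re - v.re) (b' := w.im) (H := H) (j := j) hv hH hn
  have e : v.re - x₀ + (w.re - v.re) = w.re - x₀ := by ring
  rw [e] at h
  push_cast
  exact h

/-- A `QWin` upper zero of `f^{(j)} ≢ 0` of height `≤ Hs` is a level-`j` BAND state (tree `band_of_quad'`). -/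
theorem stTrkDQ_of_qWin {η : ℝ} {f : ℂ → ℂ} {x₀ s hmax R Hs : ℝ} {B j : ℕ} {u : ℂ} (hE : EngineHyps5 2 η f x₀ s hmax R Hs B)
    (hnz : iteratedDeriv j f ≠ 0) (hu : iteratedDeriv j f u = 0) (hup : 0 < u.im) (hH : u.im ≤ Hs) (hq : QWin x₀ Hs j u) :
    StTrkDQ η f x₀ s hmax R Hs B j u := by
  obtain ⟨-, hR, -, -⟩ := frame_pos hE
  unfold QWin at hq
  exact ⟨hnz, hu, hup, band_of_quad' hR.le hq, hH⟩

/-! ## §3 Non-terminality of non-Ready′ levels -/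

/-- ★ If `f^{(j)} ≢ 0` but `f^{(j+1)} ≡ 0`, then level `j` is Ready′: `f^{(j)}` is a non-zero REAL constant, `f^{(j+1)} = f^{(j+2)} = 0`, so `x₀`
carries a (degenerate) 421-event `NLEventOf f j x₀` inside the range. -/
theorem readyR2_of_iteratedDeriv_succ_eq_zero {η : ℝ} {f : ℂ → ℂ} {x₀ s hmax R Hs : ℝ} {B : ℕ} (hE : EngineHyps5 2 η f x₀ s hmax R Hs B)
    {j : ℕ} (hj : iteratedDeriv j f ≠ 0) (hj1 : iteratedDeriv (j + 1) f = 0) (v : ℂ) : ReadyR2 η f x₀ s hmax R Hs B j v := by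
  obtain ⟨-, hR, -, -⟩ := frame_pos hE
  have hdj : Differentiable ℂ (iteratedDeriv j f) := differentiable_iteratedDeriv_of_entire hE.1 j
  have hd0 : ∀ z : ℂ, deriv (iteratedDeriv j f) z = 0 := fun z => by rw [← iteratedDeriv_succ, hj1]; rfl
  have hconst : ∀ z : ℂ, iteratedDeriv j f z = iteratedDeriv j f (x₀ : ℂ) := fun z => is_const_of_deriv_eq_zero hdj hd0 z x₀
  have hc : iteratedDeriv j f (x₀ : ℂ) ≠ 0 := by
    intro h0
    exact hj (funext fun z => by rw [hconst z, h0]; rfl)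
  have hcim : (iteratedDeriv j f (x₀ : ℂ)).im = 0 := im_iteratedDeriv_ofReal hE.1 hE.2.1 j x₀
  have hcre : (iteratedDeriv j f (x₀ : ℂ)).re ≠ 0 := by
    intro h0
    exact hc (Complex.ext (by simpa using h0) (by simpa using hcim))
  have h1 : (iteratedDeriv (j + 1) f (x₀ : ℂ)).re = 0 := by rw [hj1]; rfl
  have h2f : iteratedDeriv (j + 2) f = fun _ => 0 := by
    rw [iteratedDeriv_succ, hj1]
    exact deriv_const' 0
  have h2 : (iteratedDeriv (j + 2) f (x₀ : ℂ)).re = 0 := by rw [h2f]; rfl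
  have hdist : |x₀ - x₀| < ((j : ℝ) + 3) * R / 2 := by
    rw [sub_self, abs_zero]; positivity
  refine ⟨j, le_rfl, Or.inr ⟨x₀, hdist, h1, hcre, ?_⟩⟩
  rw [h2, mul_zero]

/-- ★ Hence a non-Ready′ level carries `f^{(j)} ≢ 0` AND `f^{(j+1)} ≢ 0` (induction on `j`: `f ≢ 0` on a legal frame, and a vanishing
derivative past a non-vanishing one makes that level — and every later one — Ready′). -/
theorem iteratedDeriv_ne_zero_of_not_readyR2 {η : ℝ} {f : ℂ → ℂ} {x₀ s hmax R Hs : ℝ} {B : ℕ} (hE : EngineHyps5 2 η f x₀ s hmax R Hs B) :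
    ∀ (j : ℕ) (v : ℂ), ¬ ReadyR2 η f x₀ s hmax R Hs B j v → iteratedDeriv j f ≠ 0 ∧ iteratedDeriv (j + 1) f ≠ 0 := by
  intro j
  induction j with
  | zero =>
    intro v hnr
    have h0 := iteratedDeriv_zero_ne_zero hE
    exact ⟨h0, fun h1 => hnr (readyR2_of_iteratedDeriv_succ_eq_zero hE h0 h1 v)⟩
  | succ j ih =>
    intro v hnr
    have hnr' : ¬ ReadyR2 η f x₀ s hmax R Hs B j v := fun h => hnr (readyR2_mono h (Nat.le_succ j))
    have hj1 : iteratedDeriv (j + 1) f ≠ 0 := (ih v hnr').2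
    exact ⟨hj1, fun h2 => hnr (readyR2_of_iteratedDeriv_succ_eq_zero hE hj1 h2 v)⟩

/-! ## §4 The repaired doors in BAND currency, and `BandLineageLawQ ↔ StepLawQ ↔ RestSuccBotQ` -/

/-- ★★ DOOR (state-free BAND LINEAGE LAW): on a legal frame, a (cumulatively) non-Ready′ level `j` has an INHABITED band level `j+1`
(`v` is a dummy — `ReadyR2` is state-free). Open; = C6 ADD-126 (4)(ii)'s surviving shape; equivalent to STUB 1 (`restSuccBotQ_iff_bandLineageLawQ`). -/
def BandLineageLawQ : Prop :=
  ∀ (η : ℝ) (f : ℂ → ℂ) (x₀ s hmax R Hs : ℝ) (B : ℕ), EngineHyps5 2 η f x₀ s hmax R Hs B → ∀ (j : ℕ) (v : ℂ),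
    ¬ ReadyR2 η f x₀ s hmax R Hs B j v → ∃ u : ℂ, StTrkDQ η f x₀ s hmax R Hs B (j + 1) u

/-- ★★ DOOR (ONE-STEP BAND LAW): a level-`j` band state at a non-Ready′ level ⇒ a level-`(j+1)` band state (any — not tied to `v`).
Open; equivalent to STUB 1 (`restSuccBotQ_iff_stepLawQ`). -/
def StepLawQ : Prop :=
  ∀ (η : ℝ) (f : ℂ → ℂ) (x₀ s hmax R Hs : ℝ) (B : ℕ), EngineHyps5 2 η f x₀ s hmax R Hs B → ∀ (j : ℕ) (v : ℂ),
    StTrkDQ η f x₀ s hmax R Hs B j v → ¬ ReadyR2 η f x₀ s hmax R Hs B j v → ∃ u : ℂ, StTrkDQ η f x₀ s hmax R Hs B (j + 1) u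

/-- (K) the state-free law gives the one-step law (drop the state). -/
theorem stepLawQ_of_bandLineageLawQ (h : BandLineageLawQ) : StepLawQ :=
  fun η f x₀ s hmax R Hs B hE j v _ hnr => h η f x₀ s hmax R Hs B hE j v hnr

/-- (K) level 0 of the band family is inhabited on every legal frame (the reflected seed `w₀`; tree `init0Sig_stTrkDQ`). -/
theorem exists_stTrkDQ_zero {η : ℝ} {f : ℂ → ℂ} {x₀ s hmax R Hs : ℝ} {B : ℕ} (hE : EngineHyps5 2 η f x₀ s hmax R Hs B) :
    ∃ u : ℂ, StTrkDQ η f x₀ s hmax R Hs B 0 u := by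
  obtain ⟨u, hu, -⟩ := init0Sig_stTrkDQ η f x₀ s hmax R Hs B hE
  exact ⟨u, hu⟩

/-- (K) ★ the one-step law gives the state-free law (induction on the level from the seed; Ready′ is cumulative). -/
theorem bandLineageLawQ_of_stepLawQ (h : StepLawQ) : BandLineageLawQ := by
  intro η f x₀ s hmax R Hs B hE j
  induction j with
  | zero =>
    intro v hnr
    obtain ⟨u, hu⟩ := exists_stTrkDQ_zero hE
    exact h η f x₀ s hmax R Hs B hE 0 u hu (fun hr => hnr (readyR2_mono hr le_rfl))
  | succ j ih =>
    intro v hnr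
    obtain ⟨u, hu⟩ := ih v (fun hr => hnr (readyR2_mono hr (Nat.le_succ j)))
    exact h η f x₀ s hmax R Hs B hE (j + 1) u hu (fun hr => hnr (readyR2_mono hr le_rfl))

/-- ★★ (K) `BandLineageLawQ ↔ StepLawQ`. -/
theorem bandLineageLawQ_iff_stepLawQ : BandLineageLawQ ↔ StepLawQ :=
  ⟨stepLawQ_of_bandLineageLawQ, bandLineageLawQ_of_stepLawQ⟩

/-- ★★ (K) STUB 1 ⟸ the one-step law (via `chargedBot_iffQ`; no dimple / window lemma involved). -/
theorem restSuccBotQ_of_stepLawQ (h : StepLawQ) : RestSuccBotQ := by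
  intro η f x₀ s hmax R Hs B hE j hch
  obtain ⟨v, hlow, hnr, -⟩ := chargedBot_iffQ.mp hch
  exact h η f x₀ s hmax R Hs B hE j v hlow.1 hnr

/-- ★★ (K) … and conversely: STUB 1 ⇒ the one-step law (if level `j+1` is empty, the lowest state of level `j` is charged). -/
theorem stepLawQ_of_restSuccBotQ (h : RestSuccBotQ) : StepLawQ := by
  intro η f x₀ s hmax R Hs B hE j v hv hnr
  by_cases hex : ∃ u : ℂ, StTrkDQ η f x₀ s hmax R Hs B (j + 1) u
  · exact hex
  · obtain ⟨v', hlow⟩ := hasLowestSig_of_levelFinite levelFinite_stTrkDQ η f x₀ s hmax R Hs B hE j v hv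
    have hnr' : ¬ ReadyR2 η f x₀ s hmax R Hs B j v' := fun hr => hnr (readyR2_mono hr le_rfl)
    exact h η f x₀ s hmax R Hs B hE j (chargedBot_iffQ.mpr ⟨v', hlow, hnr', fun u' hu' => absurd ⟨u', hu'⟩ hex⟩)

/-- ★★★ (K) **STUB 1 IS THE ONE-STEP BAND LAW**: `RestSuccBotQ ↔ StepLawQ`. -/
theorem restSuccBotQ_iff_stepLawQ : RestSuccBotQ ↔ StepLawQ :=
  ⟨stepLawQ_of_restSuccBotQ, restSuccBotQ_of_stepLawQ⟩

/-- ★★★ (K) **STUB 1 IS THE STATE-FREE BAND LINEAGE LAW**: `RestSuccBotQ ↔ BandLineageLawQ`. -/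
theorem restSuccBotQ_iff_bandLineageLawQ : RestSuccBotQ ↔ BandLineageLawQ :=
  restSuccBotQ_iff_stepLawQ.trans bandLineageLawQ_iff_stepLawQ.symm

/-- (K) STUB 1 from the band lineage law, by name. -/
theorem restSuccBotQ_of_bandLineageLawQ (h : BandLineageLawQ) : RestSuccBotQ :=
  restSuccBotQ_iff_bandLineageLawQ.mpr h

/-- (K) for the record: the band lineage law discharges `AntiEscape` (its `IsLowest` / ¬window / ¬dimple hypotheses unused). -/
theorem antiEscape_of_bandLineageLawQ (h : BandLineageLawQ) : AntiEscape :=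
  fun η f x₀ s hmax R Hs B hE j v _ hnr _ _ => h η f x₀ s hmax R Hs B hE j v hnr

/-! ## §5 The pure-Q doors: `QTheftLawQ ⇒ QStepLawQ ⇒ QLineageLawQ ⇒ BandLineageLawQ` -/

/-- ★★ DOOR (PURE-Q LINEAGE LAW, sharper than `BandLineageLawQ`): a non-Ready′ level `j` of a legal frame has an upper zero of `f^{(j+1)}`
in the pure window `QWin x₀ Hs (j+1)` (then `Im u ≤ Hs` automatically, `im_le_of_qWin_succ`). Open; census target (C6 sqC / critic colaw
corpora: per cumulatively non-Ready′ level `k`, is there an upper zero `u` of `f^{(k+1)}` with `(Re u − x₀)² + (k+1)·Im u² ≤ (k+1)·Hs²`?). -/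
def QLineageLawQ : Prop :=
  ∀ (η : ℝ) (f : ℂ → ℂ) (x₀ s hmax R Hs : ℝ) (B : ℕ), EngineHyps5 2 η f x₀ s hmax R Hs B → ∀ (j : ℕ) (v : ℂ),
    ¬ ReadyR2 η f x₀ s hmax R Hs B j v → ∃ u : ℂ, iteratedDeriv (j + 1) f u = 0 ∧ 0 < u.im ∧ QWin x₀ Hs (j + 1) u

/-- ★★ DOOR (PURE-Q ONE-STEP LAW): an upper zero `v` of `f^{(j)}` of height `≤ Hs` in `QWin x₀ Hs j` at a non-Ready′ level ⇒ an upper zero of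
`f^{(j+1)}` in `QWin x₀ Hs (j+1)` (ANY — not necessarily nested under `v`; the nested case is the theorem `qWin_step`). Open. -/
def QStepLawQ : Prop :=
  ∀ (η : ℝ) (f : ℂ → ℂ) (x₀ s hmax R Hs : ℝ) (B : ℕ), EngineHyps5 2 η f x₀ s hmax R Hs B → ∀ (j : ℕ) (v : ℂ),
    iteratedDeriv j f v = 0 → 0 < v.im → v.im ≤ Hs → QWin x₀ Hs j v → ¬ ReadyR2 η f x₀ s hmax R Hs B j v →
    ∃ u : ℂ, iteratedDeriv (j + 1) f u = 0 ∧ 0 < u.im ∧ QWin x₀ Hs (j + 1) u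

/-- ★★ DOOR (PURE-Q THEFT RESIDUAL): as `QStepLawQ`, under the extra hypothesis that NO upper zero of `f^{(j+1)}` is nested under `v`
(every child of `v` went real or was stolen — by `nestedStep_of_unhosted`, every upper critical point off the zero set of `f^{(j)}` is then
hosted strictly inside another pair's Jensen disc). Open; the theft-only content of the pure-Q line (cf. `AntiTheft` for the lowest state). -/
def QTheftLawQ : Prop :=
  ∀ (η : ℝ) (f : ℂ → ℂ) (x₀ s hmax R Hs : ℝ) (B : ℕ), EngineHyps5 2 η f x₀ s hmax R Hs B → ∀ (j : ℕ) (v : ℂ),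
    iteratedDeriv j f v = 0 → 0 < v.im → v.im ≤ Hs → QWin x₀ Hs j v → ¬ ReadyR2 η f x₀ s hmax R Hs B j v →
    (∀ w : ℂ, iteratedDeriv (j + 1) f w = 0 → 0 < w.im → ¬ NestedStep v w) →
    ∃ u : ℂ, iteratedDeriv (j + 1) f u = 0 ∧ 0 < u.im ∧ QWin x₀ Hs (j + 1) u

/-- (K) ★ the NESTED case of the pure-Q step is a theorem, so `QTheftLawQ → QStepLawQ`. -/
theorem qStepLawQ_of_qTheftLawQ (h : QTheftLawQ) : QStepLawQ := by
  intro η f x₀ s hmax R Hs B hE j v hv hvim hvH hq hnr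
  by_cases hex : ∃ w : ℂ, iteratedDeriv (j + 1) f w = 0 ∧ 0 < w.im ∧ NestedStep v w
  · obtain ⟨w, hw, hwim, hn⟩ := hex
    exact ⟨w, hw, hwim, qWin_step hq (pow_le_pow_left₀ hvim.le hvH 2) hn⟩
  · push Not at hex
    exact h η f x₀ s hmax R Hs B hE j v hv hvim hvH hq hnr (fun w hw hwim hn => hex w hw hwim hn)

/-- (K) the seed: an upper zero of `f` ON the column line `Re = x₀`, of height `≤ Hs` — a `QWin x₀ Hs 0` zero (tree `init0Sig_chainOf` + `chainOf_zero_iff`). -/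
theorem exists_seed_qWin {η : ℝ} {f : ℂ → ℂ} {x₀ s hmax R Hs : ℝ} {B : ℕ} (hE : EngineHyps5 2 η f x₀ s hmax R Hs B) :
    ∃ u : ℂ, iteratedDeriv 0 f u = 0 ∧ 0 < u.im ∧ u.im ≤ Hs ∧ QWin x₀ Hs 0 u := by
  obtain ⟨u, hu, -⟩ := init0Sig_chainOf TrkStepD η f x₀ s hmax R Hs B hE
  obtain ⟨h0, hre⟩ := (chainOf_zero_iff TrkStepD η f x₀ s hmax R Hs B u).mp hu
  exact ⟨u, h0.2.1, h0.2.2.1, h0.2.2.2.2, qWin_zero_iff.mpr hre⟩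

/-- ★★ (K) `QStepLawQ → QLineageLawQ` (induction on the level from the seed `w₀ ∈ QWin x₀ Hs 0`; Ready′ cumulative). -/
theorem qLineageLawQ_of_qStepLawQ (h : QStepLawQ) : QLineageLawQ := by
  intro η f x₀ s hmax R Hs B hE j
  obtain ⟨-, -, hHs, -⟩ := frame_pos hE
  induction j with
  | zero =>
    intro v hnr
    obtain ⟨u, hu, hup, hH, hq⟩ := exists_seed_qWin hE
    exact h η f x₀ s hmax R Hs B hE 0 u hu hup hH hq (fun hr => hnr (readyR2_mono hr le_rfl))
  | succ j ih =>
    intro v hnr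
    obtain ⟨u, hu, hup, hq⟩ := ih v (fun hr => hnr (readyR2_mono hr (Nat.le_succ j)))
    exact h η f x₀ s hmax R Hs B hE (j + 1) u hu hup (im_le_of_qWin_succ hHs hq) hq (fun hr => hnr (readyR2_mono hr le_rfl))

/-- ★★ (K) `QLineageLawQ → BandLineageLawQ` (a pure-Q zero is a band state; `f^{(j+1)} ≢ 0` by non-terminality). -/
theorem bandLineageLawQ_of_qLineageLawQ (h : QLineageLawQ) : BandLineageLawQ := by
  intro η f x₀ s hmax R Hs B hE j v hnr
  obtain ⟨u, hu, hup, hq⟩ := h η f x₀ s hmax R Hs B hE j v hnr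
  obtain ⟨-, -, hHs, -⟩ := frame_pos hE
  exact ⟨u, stTrkDQ_of_qWin hE (iteratedDeriv_ne_zero_of_not_readyR2 hE j v hnr).2 hu hup (im_le_of_qWin_succ hHs hq) hq⟩

/-- (K) STUB 1 from the pure-Q lineage law. -/
theorem restSuccBotQ_of_qLineageLawQ (h : QLineageLawQ) : RestSuccBotQ :=
  restSuccBotQ_of_bandLineageLawQ (bandLineageLawQ_of_qLineageLawQ h)

/-- (K) STUB 1 from the pure-Q one-step law. -/
theorem restSuccBotQ_of_qStepLawQ (h : QStepLawQ) : RestSuccBotQ :=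
  restSuccBotQ_of_qLineageLawQ (qLineageLawQ_of_qStepLawQ h)

/-- (K) STUB 1 from the pure-Q theft residual. -/
theorem restSuccBotQ_of_qTheftLawQ (h : QTheftLawQ) : RestSuccBotQ :=
  restSuccBotQ_of_qStepLawQ (qStepLawQ_of_qTheftLawQ h)

/-- (K) hence LAW 421 by names from the pure-Q theft residual and the RATE stub: `QTheftLawQ → RestRateBotQ → TiltedLandingLaw421`. -/
theorem law421T_of_qTheft_rateQ (hT : QTheftLawQ) (hR : RestRateBotQ) :
    Summit.RiemannHypothesis.RiemannHypothesis.Theses.EarlyAppointments.TiltedLandingLaw421 :=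
  law421T_of_succ_rateQ (restSuccBotQ_of_qTheftLawQ hT) hR

/-- (K) and from the state-free band lineage law: `BandLineageLawQ → RestRateBotQ → TiltedLandingLaw421`. -/
theorem law421T_of_bandLineage_rateQ (hB : BandLineageLawQ) (hR : RestRateBotQ) :
    Summit.RiemannHypothesis.RiemannHypothesis.Theses.EarlyAppointments.TiltedLandingLaw421 :=
  law421T_of_succ_rateQ (restSuccBotQ_of_bandLineageLawQ hB) hR

end RhW08.LineageQ
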